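import Summits.PneNP.PneNP.Theorems.GapMCSPWindowCellZeroPotential

/-!
# Gap-MCSP window cell `q = 0` (trade-off law) — VI. The relevant roots: closure, link, locality

Part of the tree landing of HOME/decomp-pnenp-lens-1/TradeOffLaw.lean (sha256 880b490f…, lens-1 g13 of the decomp-pnenp root-decomposition cell; critic NODE-VERDICT 2026-08-30T13:09:32Z CLEARED, landing endorsed (6)(a)):
a SIZE–ACCEPTANCE TRADE-OFF for every `B₂`-circuit on `N` inputs that accepts `0^N` and every point
indicator `e_p` — `N ≤ 9·L·(L + G + 3 − N)`, `L = ⌊log₂ acc⌋`, `G` = number of gates — and its payout: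
the Oliveira–Pich–Santhanam gap problem `Gap-MCSP[2^{βn}/(cn), 2^{βn}]` (census R3) is not separated by
`B₂`-circuit families of eventually `≤ N` gates (`0 < β < 1/3`, every `c ≥ 1`), i.e. the `q = 0` cell of
the window dial of route `route-PneNP-RootDecompMagnificationPayout` (item stmt-PneNP-33309 `WindowCellZero`,
BC5 rung for the attacked item stmt-PneNP-32096). Modules, in dependency order: `…Formulas` (rooted
`B₂`-formulas and additive valuations) → `…Counting` (uniform counting, silent/flipping variables, numeric
helpers) → `…FlipLaw` (the exact acceptance law for read-once formulas) → `…Unfolding` (rooted unfolding of a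
gate list, consistency, references) → `…Potential` (variables/nodes of unfoldings, the root potential: no
duplication across root formulas) → `…Relevance` (relevant roots, link, locality) → `…Product` (boxes, the two
exponent bounds, pigeonhole, the final arithmetic) → `…Count` (`t + 2·nocc ≤ 2G + 3`) → `GapMCSPWindowCellZero`
(the law proved, the payout in tree vocabulary). Proof-internal machinery: nothing here bears on P vs NP
beyond the S-free lower bound it proves; all statements are [folklore]-tagged kernel lemmas of the lens.

THIS FILE (lens §5): the root predicate `isRoot gs m₀` (input read `≥ 2` times, gate of fan-out `≥ 2`, or
the output `m₀`), the formula `form` of a wire, actual wire values `aw`, ranks; `Rel gs m₀` = the least set of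
wires containing the output and closed under references of the unfoldings; EVAL (`form_eval_aw`), LINK (an
environment self-consistent on `Rel` at `x` is the true wire vector of `x` there), LOCALITY (`aw_congr`); and
no duplication: root formulas are read-once with pairwise disjoint variables and disjoint gate nodes.
-/

noncomputable section

set_option linter.dupNamespace false -- `Summit.PneNP.PneNP.…`: summit = sub-problem name (D-0017 single-conjunct layout)

namespace Summit.PneNP.PneNP.Theorems.GapMCSPWindowCellZero

open Literature.Computability.Complexity

/-! ## §5 THE RELEVANT ROOTS: closure of the output under references, consistency, locality

`isRoot gs m₀`: input read `≥ 2` times, or gate of fan-out `≥ 2`, or the output gate `m₀`.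
`Rel gs m₀`: the least set of wires containing the output and closed under "references of the
rooted unfolding" — the roots the output actually depends on through the unfoldings (dead
structure hanging off shared wires is NOT in it, which is what makes the count below work). -/

section Relevance

open Finset
open Literature.Computability.Complexity.GateList

variable {N : ℕ}

namespace BF

/-- The root predicate. [folklore] -/
def isRoot (gs : List (Gate (Fin N))) (m₀ : ℕ) : Fin N ⊕ ℕ → Bool
  | .inl i => decide (2 ≤ reads gs i)
  | .inr m => decide (2 ≤ refL gs m ∨ m = m₀)

/-- Non-root gates have fan-out `≤ 1` (by definition of `isRoot`). [folklore] -/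
theorem isRoot_hfo (gs : List (Gate (Fin N))) (m₀ : ℕ) :
    ∀ m, isRoot gs m₀ (.inr m) = false → refL gs m ≤ 1 := by
  intro m hm
  simp only [isRoot, decide_eq_false_iff_not, not_or, not_le] at hm
  omega

/-- The formula of a wire: a literal for an input wire, the rooted unfolding for a gate wire. -/
def form (gs : List (Gate (Fin N))) (m₀ : ℕ) : Fin N ⊕ ℕ → BF N
  | .inl i => lit i true
  | .inr m => UR (isRoot gs m₀) gs m

/-- The actual value of a wire at input `x`. -/
def aw (gs : List (Gate (Fin N))) (x : Fin N → Bool) (w : Fin N ⊕ ℕ) : Bool := wireOf x (vals gs x) w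

/-- The actual value of an input wire is the input bit. -/
@[simp] theorem aw_inl (gs : List (Gate (Fin N))) (x : Fin N → Bool) (i : Fin N) :
    aw gs x (.inl i) = x i := rfl

/-- The actual value of a gate wire is the recorded gate value. -/
theorem aw_inr (gs : List (Gate (Fin N))) (x : Fin N → Bool) (m : ℕ) :
    aw gs x (.inr m) = (vals gs x).getD m false := rfl

/-- Rank of a wire (inputs first, then gates in program order). -/
def rk : Fin N ⊕ ℕ → ℕ
  | .inl _ => 0
  | .inr m => m + 1

/-- All wires of the program. -/
def allW (gs : List (Gate (Fin N))) : Finset (Fin N ⊕ ℕ) :=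
  (univ : Finset (Fin N)).map ⟨Sum.inl, Sum.inl_injective⟩ ∪
    (range gs.length).map ⟨Sum.inr, Sum.inr_injective⟩

/-- Every input wire is a wire of the program. -/
@[simp] theorem inl_mem_allW (gs : List (Gate (Fin N))) (i : Fin N) : (Sum.inl i) ∈ allW gs := by
  simp [allW]

/-- `inr m` is a wire of the program iff `m` is a gate index. -/
@[simp] theorem inr_mem_allW (gs : List (Gate (Fin N))) (m : ℕ) :
    (Sum.inr m : Fin N ⊕ ℕ) ∈ allW gs ↔ m < gs.length := by
  simp [allW]

/-- Sets of wires containing the output and closed under references of the unfoldings. -/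
def Closed (gs : List (Gate (Fin N))) (m₀ : ℕ) (S : Finset (Fin N ⊕ ℕ)) : Prop :=
  (Sum.inr m₀ : Fin N ⊕ ℕ) ∈ S ∧
    ∀ m, (Sum.inr m : Fin N ⊕ ℕ) ∈ S → (UR (isRoot gs m₀) gs m).refs ⊆ S

open Classical in
/-- **The relevant roots**: the least closed set of wires. [folklore] -/
def Rel (gs : List (Gate (Fin N))) (m₀ : ℕ) : Finset (Fin N ⊕ ℕ) :=
  (allW gs).filter fun w => ∀ S, S ⊆ allW gs → Closed gs m₀ S → w ∈ S

/-- Membership in `Rel`, unfolded. -/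
theorem mem_Rel {gs : List (Gate (Fin N))} {m₀ : ℕ} {w : Fin N ⊕ ℕ} :
    w ∈ Rel gs m₀ ↔ w ∈ allW gs ∧ ∀ S, S ⊆ allW gs → Closed gs m₀ S → w ∈ S := by
  classical
  unfold Rel
  rw [mem_filter]

section Fixed

variable {gs : List (Gate (Fin N))} {m₀ : ℕ}

/-- Relevant gate wires are gate indices of the program. -/
theorem lt_of_inr_mem_Rel {m : ℕ} (hm : (Sum.inr m) ∈ Rel gs m₀) : m < gs.length := by
  have := (mem_Rel.1 hm).1
  simpa using this

/-- The output gate is relevant. [folklore] -/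
theorem out_mem_Rel (hm₀ : m₀ < gs.length) : (Sum.inr m₀) ∈ Rel gs m₀ :=
  mem_Rel.2 ⟨by simpa using hm₀, fun _ _ hS => hS.1⟩

/-- `Rel` is closed. -/
theorem refs_subset_Rel (hwf : WFL gs) {m : ℕ} (hm : (Sum.inr m) ∈ Rel gs m₀) :
    (UR (isRoot gs m₀) gs m).refs ⊆ Rel gs m₀ := by
  intro w hw
  have hmG := lt_of_inr_mem_Rel hm
  obtain ⟨-, h2⟩ := refs_UR (isRoot gs m₀) gs hwf m w hw
  refine mem_Rel.2 ⟨?_, fun S hS hC => hC.2 m ((mem_Rel.1 hm).2 S hS hC) hw⟩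
  cases w with
  | inl i => simp
  | inr m' => simpa using (h2 m' rfl).2

/-- `Rel` is generated: every relevant wire other than the output is referenced by a relevant
gate. -/
theorem exists_parent (hwf : WFL gs) (hm₀ : m₀ < gs.length) {w : Fin N ⊕ ℕ} (hw : w ∈ Rel gs m₀)
    (hne : w ≠ Sum.inr m₀) : ∃ m, (Sum.inr m) ∈ Rel gs m₀ ∧ w ∈ (UR (isRoot gs m₀) gs m).refs := by
  by_contra hcon
  push Not at hcon
  have hS : Closed gs m₀ ((Rel gs m₀).erase w) := by
    refine ⟨mem_erase.2 ⟨hne.symm, out_mem_Rel hm₀⟩, fun m hm => ?_⟩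
    have hm' := (mem_erase.1 hm).2
    intro w' hw'
    refine mem_erase.2 ⟨fun h => hcon m hm' (h ▸ hw'), refs_subset_Rel hwf hm' hw'⟩
  have := (mem_Rel.1 hw).2 _ ((erase_subset _ _).trans (fun w hw => (mem_Rel.1 hw).1)) hS
  simp at this

/-- Every relevant wire is a root. -/
theorem isRoot_of_mem_Rel (hwf : WFL gs) (hm₀ : m₀ < gs.length) {w : Fin N ⊕ ℕ}
    (hw : w ∈ Rel gs m₀) : isRoot gs m₀ w = true := by
  by_cases hne : w = Sum.inr m₀
  · subst hne; simp [isRoot]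
  · obtain ⟨m, -, hm⟩ := exists_parent hwf hm₀ hw hne
    exact (refs_UR (isRoot gs m₀) gs hwf m w hm).1

/-- References of the formula of a relevant wire are relevant wires of smaller rank. -/
theorem refs_form (hwf : WFL gs) {w : Fin N ⊕ ℕ} (hw : w ∈ Rel gs m₀) :
    ∀ w' ∈ (form gs m₀ w).refs, w' ∈ Rel gs m₀ ∧ rk w' < rk w := by
  intro w' hw'
  cases w with
  | inl i => simp [form, refs] at hw'
  | inr m =>
    simp only [form] at hw'
    refine ⟨refs_subset_Rel hwf hw hw', ?_⟩
    obtain ⟨-, h2⟩ := refs_UR (isRoot gs m₀) gs hwf m w' hw'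
    cases w' with
    | inl i => simp [rk]
    | inr m' => have := (h2 m' rfl).1; simp [rk]; omega

/-- **EVAL**: in the environment of the actual wire values of `x`, the formula of every wire
evaluates at `x` to the actual value of the wire. -/
theorem form_eval_aw (hwf : WFL gs) (har : ∀ g ∈ gs, g.arity ≤ 2) (m₀ : ℕ) (w : Fin N ⊕ ℕ)
    (x : Fin N → Bool) : (form gs m₀ w).eval (aw gs x) x = aw gs x w := by
  cases w with
  | inl i => simp [form, eval]
  | inr m =>
    simp only [form, aw_inr]
    exact eval_UR (isRoot gs m₀) x gs hwf har (aw gs x) (fun _ => rfl) (fun _ _ => rfl) m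

/-- **LINK**: an environment that is self-consistent on the relevant wires at the point `x`
IS the vector of actual wire values of `x` there. -/
theorem link (hwf : WFL gs) (har : ∀ g ∈ gs, g.arity ≤ 2) {ρ : Fin N ⊕ ℕ → Bool}
    {x : Fin N → Bool} (h : ∀ w ∈ Rel gs m₀, (form gs m₀ w).eval ρ x = ρ w) :
    ∀ w ∈ Rel gs m₀, ρ w = aw gs x w := by
  suffices H : ∀ n, ∀ w ∈ Rel gs m₀, rk w ≤ n → ρ w = aw gs x w from
    fun w hw => H _ w hw le_rfl
  intro n
  induction n with
  | zero =>
    intro w hw hn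
    rw [← h w hw, eval_congr_ref (form gs m₀ w) (ρ' := aw gs x)
      (fun w' hw' => absurd (refs_form hwf hw w' hw').2 (by omega))]
    exact form_eval_aw hwf har m₀ w x
  | succ n ih =>
    intro w hw hn
    rw [← h w hw, eval_congr_ref (form gs m₀ w) (ρ' := aw gs x)
      (fun w' hw' => ih w' (refs_form hwf hw w' hw').1 (by have := (refs_form hwf hw w' hw').2; omega))]
    exact form_eval_aw hwf har m₀ w x

/-- **LOCALITY**: the actual value of a relevant wire depends only on the variables of the
formulas of relevant wires of no larger rank. -/
theorem aw_congr (hwf : WFL gs) (har : ∀ g ∈ gs, g.arity ≤ 2) {x y : Fin N → Bool} :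
    ∀ n, ∀ w ∈ Rel gs m₀, rk w ≤ n →
      (∀ w' ∈ Rel gs m₀, rk w' ≤ rk w → ∀ q ∈ (form gs m₀ w').vars, x q = y q) →
      aw gs x w = aw gs y w := by
  intro n
  induction n with
  | zero =>
    intro w hw hn hag
    rw [← form_eval_aw hwf har m₀ w x, ← form_eval_aw hwf har m₀ w y,
      eval_congr_ref (form gs m₀ w) (ρ' := aw gs y)
        (fun w' hw' => absurd (refs_form hwf hw w' hw').2 (by omega))]
    exact eval_congr _ _ (hag w hw le_rfl)
  | succ n ih =>
    intro w hw hn hag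
    rw [← form_eval_aw hwf har m₀ w x, ← form_eval_aw hwf har m₀ w y,
      eval_congr_ref (form gs m₀ w) (ρ' := aw gs y) (fun w' hw' => ?_)]
    · exact eval_congr _ _ (hag w hw le_rfl)
    · obtain ⟨h1, h2⟩ := refs_form hwf hw w' hw'
      exact ih w' h1 (by omega) (fun w'' hw'' hrk => hag w'' hw'' (by omega))

/-! ### No duplication: read-once root formulas with pairwise disjoint variables and nodes -/

/-- The root gates among `range length`. -/
def rootIdx (gs : List (Gate (Fin N))) (m₀ : ℕ) : Finset ℕ :=
  (range gs.length).filter fun m => isRoot gs m₀ (.inr m) = true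

/-- Across all root unfoldings every input variable is read at most once. [folklore] -/
theorem sum_root_mult_le_one (hwf : WFL gs) (har : ∀ g ∈ gs, g.arity ≤ 2) (p : Fin N) :
    ∑ m ∈ rootIdx gs m₀, (UR (isRoot gs m₀) gs m).mult p ≤ 1 := by
  refine (sum_root_mult_le (isRoot gs m₀) gs hwf (isRoot_hfo gs m₀) har p).trans ?_
  split_ifs with h
  · exact Nat.zero_le _
  · simp only [isRoot, Bool.not_eq_true, decide_eq_false_iff_not, not_le] at h
    omega

/-- Across all root unfoldings every gate index occurs at most once. [folklore] -/
theorem sum_root_gmult_le_one (hwf : WFL gs) (har : ∀ g ∈ gs, g.arity ≤ 2) (j : ℕ) :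
    ∑ m ∈ rootIdx gs m₀, (UR (isRoot gs m₀) gs m).gmult j ≤ 1 :=
  sum_root_gmult_le (isRoot gs m₀) gs hwf (isRoot_hfo gs m₀) har j

/-- Membership in `rootIdx`, unfolded. -/
theorem mem_rootIdx {m : ℕ} : m ∈ rootIdx gs m₀ ↔ m < gs.length ∧ isRoot gs m₀ (.inr m) = true := by
  simp [rootIdx]

/-- Root unfoldings are read-once. [folklore] -/
theorem readOnce_UR (hwf : WFL gs) (har : ∀ g ∈ gs, g.arity ≤ 2) {m : ℕ} (hm : m ∈ rootIdx gs m₀) :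
    (UR (isRoot gs m₀) gs m).ReadOnce := by
  refine readOnce_of_mult_le_one _ fun p => ?_
  exact (single_le_sum (f := fun m => (UR (isRoot gs m₀) gs m).mult p) (fun _ _ => Nat.zero_le _) hm).trans
    (sum_root_mult_le_one hwf har p)

/-- In a root unfolding the node count is the size of the node set. [folklore] -/
theorem ngates_UR (hwf : WFL gs) (har : ∀ g ∈ gs, g.arity ≤ 2) {m : ℕ} (hm : m ∈ rootIdx gs m₀) :
    (UR (isRoot gs m₀) gs m).ngates = (UR (isRoot gs m₀) gs m).nodes.card := by
  refine ngates_eq_card_nodes _ fun j => ?_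
  exact (single_le_sum (f := fun m => (UR (isRoot gs m₀) gs m).gmult j) (fun _ _ => Nat.zero_le _) hm).trans
    (sum_root_gmult_le_one hwf har j)

/-- Two distinct members with positive weight make a sum `≥ 2`. -/
theorem two_le_of_mems {s : Finset ℕ} {f : ℕ → ℕ} {m m' : ℕ} (hm : m ∈ s) (hm' : m' ∈ s)
    (hne : m ≠ m') (h1 : 1 ≤ f m) (h2 : 1 ≤ f m') : 2 ≤ ∑ i ∈ s, f i := by
  have hsub : ({m, m'} : Finset ℕ) ⊆ s := by
    intro i hi; simp only [mem_insert, mem_singleton] at hi; rcases hi with rfl | rfl <;> assumption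
  calc 2 ≤ f m + f m' := by omega
    _ = ∑ i ∈ ({m, m'} : Finset ℕ), f i := by rw [sum_pair hne]
    _ ≤ _ := sum_le_sum_of_subset_of_nonneg hsub (fun _ _ _ => Nat.zero_le _)

/-- Distinct root unfoldings read disjoint sets of variables. [folklore] -/
theorem disjoint_vars_UR (hwf : WFL gs) (har : ∀ g ∈ gs, g.arity ≤ 2) {m m' : ℕ}
    (hm : m ∈ rootIdx gs m₀) (hm' : m' ∈ rootIdx gs m₀) (hne : m ≠ m') :
    Disjoint (UR (isRoot gs m₀) gs m).vars (UR (isRoot gs m₀) gs m').vars := by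
  rw [Finset.disjoint_left]
  intro p hp hp'
  have h1 := (mem_vars_iff_mult _ p).1 hp
  have h2 := (mem_vars_iff_mult _ p).1 hp'
  have := two_le_of_mems (f := fun m => (UR (isRoot gs m₀) gs m).mult p) hm hm' hne h1 h2
  have := sum_root_mult_le_one (m₀ := m₀) hwf har p
  omega

/-- Distinct root unfoldings have disjoint gate nodes. [folklore] -/
theorem disjoint_nodes_UR (hwf : WFL gs) (har : ∀ g ∈ gs, g.arity ≤ 2) {m m' : ℕ}
    (hm : m ∈ rootIdx gs m₀) (hm' : m' ∈ rootIdx gs m₀) (hne : m ≠ m') :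
    Disjoint (UR (isRoot gs m₀) gs m).nodes (UR (isRoot gs m₀) gs m').nodes := by
  rw [Finset.disjoint_left]
  intro j hj hj'
  have h1 := (mem_nodes_iff_gmult _ j).1 hj
  have h2 := (mem_nodes_iff_gmult _ j).1 hj'
  have := two_le_of_mems (f := fun m => (UR (isRoot gs m₀) gs m).gmult j) hm hm' hne h1 h2
  have := sum_root_gmult_le_one (m₀ := m₀) hwf har j
  omega

/-- Relevant gate wires are root gates. [folklore] -/
theorem inr_mem_rootIdx (hwf : WFL gs) (hm₀ : m₀ < gs.length) {m : ℕ} (hm : (Sum.inr m) ∈ Rel gs m₀) :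
    m ∈ rootIdx gs m₀ :=
  mem_rootIdx.2 ⟨lt_of_inr_mem_Rel hm, isRoot_of_mem_Rel hwf hm₀ hm⟩

/-- The formula of a relevant wire is read-once. -/
theorem readOnce_form (hwf : WFL gs) (har : ∀ g ∈ gs, g.arity ≤ 2) (hm₀ : m₀ < gs.length)
    {w : Fin N ⊕ ℕ} (hw : w ∈ Rel gs m₀) : (form gs m₀ w).ReadOnce := by
  cases w with
  | inl i => simp [form, ReadOnce]
  | inr m => exact readOnce_UR hwf har (inr_mem_rootIdx hwf hm₀ hw)

/-- Formulas of distinct relevant wires read disjoint sets of variables. -/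
theorem disjoint_form_vars (hwf : WFL gs) (har : ∀ g ∈ gs, g.arity ≤ 2) (hm₀ : m₀ < gs.length)
    {w w' : Fin N ⊕ ℕ} (hw : w ∈ Rel gs m₀) (hw' : w' ∈ Rel gs m₀) (hne : w ≠ w') :
    Disjoint (form gs m₀ w).vars (form gs m₀ w').vars := by
  have key : ∀ (i : Fin N) (m : ℕ), (Sum.inl i) ∈ Rel gs m₀ → (Sum.inr m) ∈ Rel gs m₀ →
      Disjoint (form gs m₀ (.inl i)).vars (form gs m₀ (.inr m)).vars := by
    intro i m hi hm
    simp only [form, vars, disjoint_singleton_left]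
    intro hmem
    have h1 := (vars_UR (isRoot gs m₀) gs hwf m i hmem).1
    have h2 := isRoot_of_mem_Rel hwf hm₀ hi
    rw [h1] at h2
    exact Bool.false_ne_true h2
  cases w with
  | inl i =>
    cases w' with
    | inl i' =>
      have : i ≠ i' := fun h => hne (by rw [h])
      simp [form, vars, this]
    | inr m' => exact key i m' hw hw'
  | inr m =>
    cases w' with
    | inl i' => exact (key i' m hw' hw).symm
    | inr m' =>
      simp only [form]
      exact disjoint_vars_UR hwf har (inr_mem_rootIdx hwf hm₀ hw) (inr_mem_rootIdx hwf hm₀ hw')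
        (fun h => hne (by rw [h]))

end Fixed

end BF

end Relevance

end Summit.PneNP.PneNP.Theorems.GapMCSPWindowCellZero
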